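import Literature.NumberTheory.DiophantineGeometry.BelyiDegreeThree
import Literature.NumberTheory.DiophantineGeometry.BelyiTransport
import Literature.Computability.Cryptography.CsidhActionIsomorphismProofs
import Literature.NumberTheory.EllipticCurves.VariableChangeFunctionField
import Literature.NumberTheory.DiophantineGeometry.BelyiTransportSemilinear
import Mathlib.AlgebraicGeometry.EllipticCurve.IsomOfJ
import Mathlib.AlgebraicGeometry.EllipticCurve.ModelsWithJ
import HarnessLib

/-!
# Elliptic curves of Belyi degree `3` have `j = 0`

Topic `NumberTheory/DiophantineGeometry`; companion of `BelyiDegreeThree.lean` (where `deg_B(y² = x³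
+ B) = 3` is proved) in the orbit of the named fact `javanpeykar2014_stableFaltingsHeight_le` of
`BelyiDegreeFaltingsHeight.lean`. Zapponi, [cite: Zapponi2009BelyiDegree, Example 1.2]: "There is a
unique isomorphism class of curves of Belyi degree `3`, corresponding to the elliptic curves with
`j`-invariant `0`." Here the converse half for elliptic curves: **an elliptic curve `E/K` (`char K =
0`) whose function field `K̄(E)` carries a Belyi function of degree `3` has `j(E) = 0`**
(`j_eq_zero_of_isBelyiFunction_of_finrank_eq_three`, `j_eq_zero_of_belyiDegree_eq_three`), whence
`deg_B(y² = x³ + A x) = 4` exactly (`belyiDegree_j1728_eq_four`, with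
`WeierstrassBelyi.belyiDegree_j1728` of `BelyiDegreeThree`) and, in the setting of the named fact,
`deg_B(E_Ω) ≥ 4` whenever `j(E) ≠ 0` (`four_le_belyiDegree_of_j_ne_zero`). With the function-field
isomorphism of a change of variables (`variableChangeAlgEquiv` of
`EllipticCurves/VariableChangeFunctionField`) and Mathlib's `exists_variableChange_of_j_eq`, the
Belyi degree of `K̄(E)` only depends on `j(E)` (`belyiDegree_eq_of_j_eq`), whence the full
classification **`deg_B(E) = 3 ↔ j(E) = 0`** (`belyiDegree_eq_three_iff_j_eq_zero`), `deg_B(E) = 4`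
for `j(E) = 1728` (`belyiDegree_eq_four_of_j_eq_1728`), and `h_F(E) ≤ 13·10⁶·3⁵` for all `j = 0`
curves modulo the named fact (`javanpeykar2014_stableFaltingsHeight_le.of_j_eq_zero`). By the
independence of the algebraic closure (`BelyiTransportSemilinear`), all of this holds for the
quantity `deg_B(E_Ω)` of the named fact with an arbitrary algebraic closure `Ω` (section
`AnyClosure`), and the fact itself is equivalent to its restriction to `Ω = K̄`
(`javanpeykar2014_stableFaltingsHeight_le_iff_geom`). Everything is proved; no named fact is
introduced.

## Proof

Let `f ∈ K̄(E)` be a Belyi function with `[K̄(E) : K̄(f)] = 3`. By Riemann–Hurwitz in genus one the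
three special fibres are single points of multiplicity `3`
(`IsBelyiFunction.ord_eq_three_of_finrank_eq_three`). Translating by the pole `S` of `f` (the
automorphism `τ_S^*` of `K̄(E)`, `ordAt_transAlgHom` of the tree's `FunctionFieldTranslation` /
`IsogenyRamification`; Belyi functions and degrees are transported, `BelyiTransport`) we may assume
the pole is `O`, so `f ∈ L(3 O) = ⟨1, x, y⟩`: `f = a + b x + c y`, `c ≠ 0`
(`Csidh.exists_eq_lin_of_ordAt`, Silverman III.3.1). For `c' ∈ {0, 1}` the function `u = (f - c')/c
= y - L(x)`, `L = μ x + κ_{c'}` (`μ = -b/c`), has divisor `3 P - 3 O` with `P = (e, ·)` affine. If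
`v_P(x - e) = 1`, the norm `N_L(x) = -u ū = x³ + (a₂ - μ² - a₁ μ) x² + ⋯` (`ū` the conjugate of `u`
over `K̄(x)`) has `v_P(N_L(x)) ≥ 3`, so `N_L = (X - e)³` and `a₂ - μ² - a₁μ = -3e`, `a₄ - (2μ + a₁)κ
- a₃ μ = 3e²`. If `v_P(x - e) = 2` then `u² = λ (x - e)³`, and comparing the `y`-components in the
`K̄[x]`-basis `1, y` gives `2μ + a₁ = 0`, `2κ + a₃ = 0`; as `κ₀ ≠ κ₁` this happens for at most one
`c'`. In all cases `2μ + a₁ = 0` (in the simple/simple case from `(2μ + a₁)(κ₀ - κ₁) = 0`), and then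
one cube identity gives `b₂ = -12 e`, `b₄ = 6 e²`, i.e. `c₄ = b₂² - 24 b₄ = 0`, `j = c₄³/Δ = 0`.

## Relation to the tree

Built on the point-indexed valuation calculus of `K̄(E)` of `NumberTheory/EllipticCurves`
(`WeierstrassPlaces`, `WeilPairingDivisors`, `IsogenyRamification`: `W.ordAt`, `W.place`,
`ordAt_transAlgHom`, `exists_eq_smul_of_ordAt_eq`, `sum_ord_eq_finrank`), on
`Computability/Cryptography/CsidhActionIsomorphismProofs` for `L(3 O) = ⟨1, x, y⟩`
(`Csidh.exists_eq_lin_of_ordAt`, Silverman III.3.1) and the `K̄[x]`-independence of `1, y`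
(`Csidh.coeffs_eq_zero_of_lin_eq_zero`), and on `BelyiDegreeThree` / `BelyiTransport` of this
topic. No definitions; the auxiliary namespace `BelyiDegreeThreeJZero` holds the lemmas.

## References

* L. Zapponi, *On the Belyi degree(s) of a curve defined over a number field*, arXiv:0904.0967
  (2009), Example 1.2. [Zapponi2009BelyiDegree]
* J. H. Silverman, *The Arithmetic of Elliptic Curves*, 2nd ed., GTM 106, Springer 2009,
  III.§1 (`b₂, b₄, c₄, j`), Prop. III.3.1 (`L(3 O) = ⟨1, x, y⟩`). [SilvermanAEC2009]
* A. Javanpeykar, *Polynomial bounds for Arakelov invariants of Belyi curves*, Algebra & Number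
  Theory 8 (2014), §1.1 (`deg_B`). [Javanpeykar2014]
-/

noncomputable section

open scoped Classical IntermediateField Polynomial.Bivariate
open Polynomial WeierstrassCurve
open Literature.NumberTheory.EllipticCurves.WeierstrassFunctionField
open Literature.Computability.Cryptography.Csidh

universe u

namespace Literature.NumberTheory.DiophantineGeometry

open AlgFunctionField

namespace BelyiDegreeThreeJZero

/-! ### The coefficient algebra (Silverman III.§1) -/

/-- **`c₄ = 0` from one flex-cube identity and the slope relation `2μ + a₁ = 0`**: if
`a₂ - μ² - a₁ μ = -3e` and `a₄ - 2μκ - a₁κ - a₃μ = 3e²` with `2μ + a₁ = 0`, then `b₂ = -12e`,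
`b₄ = 6e²` and `c₄ = b₂² - 24 b₄ = 0`. [cite: SilvermanAEC2009, III.§1] -/
theorem c₄_eq_zero_of_cube {k : Type*} [CommRing k] (V : WeierstrassCurve k) {μ κ e : k}
    (hμ : 2 * μ + V.a₁ = 0) (h2 : V.a₂ - μ ^ 2 - V.a₁ * μ = -3 * e)
    (h1 : V.a₄ - 2 * μ * κ - V.a₁ * κ - V.a₃ * μ = 3 * e ^ 2) : V.c₄ = 0 := by
  have hb₂ : V.b₂ = -12 * e := by
    rw [WeierstrassCurve.b₂]; linear_combination 4 * h2 + (2 * μ + V.a₁) * hμ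
  have hb₄ : V.b₄ = 6 * e ^ 2 := by
    rw [WeierstrassCurve.b₄]; linear_combination 2 * h1 + (V.a₃ + 2 * κ) * hμ
  rw [WeierstrassCurve.c₄, hb₂, hb₄]; ring

/-- **The slope relation from two parallel flex lines**: if the cubes sit at `e₀`, `e₁` for two
lines `Y = μX + κ₀`, `Y = μX + κ₁` with `κ₀ ≠ κ₁`, then `e₀ = e₁` (comparing the `X²`-terms) and
`(2μ + a₁)(κ₀ - κ₁) = 0`, so `2μ + a₁ = 0` (characteristic `0`). [cite: SilvermanAEC2009, III.§1] -/
theorem two_mul_add_a₁_eq_zero_of_cubes {k : Type*} [Field k] [CharZero k] (V : WeierstrassCurve k)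
    {μ κ₀ κ₁ e₀ e₁ : k} (hκ : κ₀ ≠ κ₁) (h2 : V.a₂ - μ ^ 2 - V.a₁ * μ = -3 * e₀)
    (h2' : V.a₂ - μ ^ 2 - V.a₁ * μ = -3 * e₁)
    (h1 : V.a₄ - 2 * μ * κ₀ - V.a₁ * κ₀ - V.a₃ * μ = 3 * e₀ ^ 2)
    (h1' : V.a₄ - 2 * μ * κ₁ - V.a₁ * κ₁ - V.a₃ * μ = 3 * e₁ ^ 2) : 2 * μ + V.a₁ = 0 := by
  have he : e₀ = e₁ := by
    have h3 : (3 : k) * e₀ = 3 * e₁ := by linear_combination h2 - h2'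
    exact mul_left_cancel₀ (by norm_num : (3 : k) ≠ 0) h3
  subst he
  have h0 : (2 * μ + V.a₁) * (κ₀ - κ₁) = 0 := by linear_combination h1' - h1
  rcases mul_eq_zero.1 h0 with h | h
  · exact h
  · exact absurd (sub_eq_zero.1 h) hκ

/-- **The norm of a line function**: for `u = y - (μx + κ)` and its conjugate
`ū = -y - a₁x - a₃ - (μx + κ)` over `k(x)`, `u · ū = -N_L(x)` with
`N_L = X³ + (a₂ - μ² - a₁μ)X² + (a₄ - 2μκ - a₁κ - a₃μ)X + (a₆ - κ² - a₃κ)`, for any solution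
`(x, y)` of the Weierstrass equation in a `k`-algebra. [cite: SilvermanAEC2009, III.§1] -/
theorem line_mul_conj {k F : Type*} [Field k] [CommRing F] [Algebra k F] (V : WeierstrassCurve k)
    {x y : F} (heq : y ^ 2 + algebraMap k F V.a₁ * x * y + algebraMap k F V.a₃ * y -
      (x ^ 3 + algebraMap k F V.a₂ * x ^ 2 + algebraMap k F V.a₄ * x + algebraMap k F V.a₆) = 0)
    (μ κ : k) :
    (y - (algebraMap k F μ * x + algebraMap k F κ)) *
        (-y - algebraMap k F V.a₁ * x - algebraMap k F V.a₃ -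
          (algebraMap k F μ * x + algebraMap k F κ)) =
      -aeval x (X ^ 3 + C (V.a₂ - μ ^ 2 - V.a₁ * μ) * X ^ 2 +
        C (V.a₄ - 2 * μ * κ - V.a₁ * κ - V.a₃ * μ) * X + C (V.a₆ - κ ^ 2 - V.a₃ * κ)) := by
  simp only [map_add, map_sub, map_mul, map_pow, map_ofNat, aeval_X, aeval_C]
  linear_combination (-1 : F) * heq

/-! ### The function field `K̄(E)`: the equation, lines and their conjugates -/

section FunctionField

variable {K : Type u} [Field K] {W : WeierstrassCurve K} [W.IsElliptic]

omit [W.IsElliptic] in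
/-- `x - a` is the image of the regular function `X - a ∈ K̄[E]`. [folklore] -/
theorem genX_sub_algebraMap (a : AlgebraicClosure K) :
    W.genX - algebraMap (AlgebraicClosure K) W.geomFunctionField a =
      algebraMap (W.baseChange (AlgebraicClosure K)).toAffine.CoordinateRing W.geomFunctionField
        (Affine.CoordinateRing.mk _ (C (X - C a))) := by
  rw [EllipticCurves.WeierstrassFunctionField.algebraMap_mk, aevalAeval_C, map_sub, aeval_X,
    aeval_C]

/-- **`v_P(x - a) > 0` at an affine point `P = (a, b)`.** [folklore] -/
theorem ordAt_genX_sub_pos {a b : AlgebraicClosure K}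
    (h : (W.baseChange (AlgebraicClosure K)).toAffine.Nonsingular a b) :
    0 < W.ordAt (.some a b h) (W.genX - algebraMap (AlgebraicClosure K) W.geomFunctionField a) := by
  have hne : W.genX - algebraMap (AlgebraicClosure K) W.geomFunctionField a ≠ 0 := fun h0 ↦
    transcendental_genX W ((sub_eq_zero.1 h0) ▸ isAlgebraic_algebraMap a)
  rw [WeierstrassCurve.ordAt, ← placeValuation_lt_one_iff_ord_pos _ hne, genX_sub_algebraMap,
    placeValuation_some_algebraMap_lt_one_iff, pointEval_mk, evalEval_C, eval_sub, eval_X, eval_C,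
    sub_self]

/-- Regular functions are regular at affine points: `v_R(G(x, y)) ≥ 0` for `R ≠ O`. [folklore] -/
theorem ordAt_algebraMap_nonneg {R : W.geomPoints} (hR : R ≠ 0)
    (w : (W.baseChange (AlgebraicClosure K)).toAffine.CoordinateRing) :
    0 ≤ W.ordAt R (algebraMap _ W.geomFunctionField w) := by
  obtain ⟨a, b, h, rfl⟩ := geomPoints.exists_eq_some hR
  by_cases hw : algebraMap _ W.geomFunctionField w = 0
  · simp [WeierstrassCurve.ordAt, ord, hw]
  · exact (placeValuation_le_one_iff_ord_nonneg _ hw).mp (placeValuation_some_algebraMap_le_one h w)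

omit [W.IsElliptic] in
/-- **The equation of `E` at the generic point**, coefficients from `K̄`:
`y² + a₁xy + a₃y - (x³ + a₂x² + a₄x + a₆) = 0` in `K̄(E)`. [folklore] -/
theorem equation_gen :
    W.genY ^ 2 + algebraMap _ W.geomFunctionField (W.baseChange (AlgebraicClosure K)).a₁ * W.genX *
        W.genY + algebraMap _ W.geomFunctionField (W.baseChange (AlgebraicClosure K)).a₃ * W.genY -
      (W.genX ^ 3 + algebraMap _ W.geomFunctionField (W.baseChange (AlgebraicClosure K)).a₂ *
        W.genX ^ 2 + algebraMap _ W.geomFunctionField (W.baseChange (AlgebraicClosure K)).a₄ *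
        W.genX + algebraMap _ W.geomFunctionField (W.baseChange (AlgebraicClosure K)).a₆) = 0 := by
  have h :=
    WeierstrassBelyi.evalEval_polynomial_eq_zero (W.baseChange (AlgebraicClosure K)).toAffine
  rw [← Affine.map_polynomial, Affine.evalEval_polynomial] at h
  exact h

/-- `ord_P 0 = 0` (junk value). [folklore] -/
theorem ordAt_zero_right (P : W.geomPoints) : W.ordAt P 0 = 0 := by
  simp [WeierstrassCurve.ordAt, ord]

/-- `ord_P` is the order at the place `W.place P` (the tree's `ord_place`). [folklore] -/
theorem ordAt_eq_ord_place (P : W.geomPoints) {u : W.geomFunctionField} (hu : u ≠ 0) :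
    W.ordAt P u = (W.place P).ord u :=
  (ord_place P hu).symm

/-- `ord_P (c u) = ord_P u` for a non-zero constant `c`. [folklore] -/
theorem ordAt_algebraMap_mul (P : W.geomPoints) {c : AlgebraicClosure K} (hc : c ≠ 0)
    (u : W.geomFunctionField) :
    W.ordAt P (algebraMap (AlgebraicClosure K) W.geomFunctionField c * u) = W.ordAt P u := by
  by_cases hu : u = 0
  · rw [hu, mul_zero]
  · rw [ordAt_mul P ((_root_.map_ne_zero _).2 hc) hu, ordAt_algebraMap, zero_add]

/-- `ord_P (-u) = ord_P u`: the point-typed `WeierstrassFunctionField.ord_neg` seen through the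
`abbrev` `W.ordAt` (kept `ordAt`-headed so that `rw [ordAt_neg]` fires on `W.ordAt` goals, like
`ordAt_mul` / `ordAt_inv` of `IsogenyRamification`). [folklore] -/
theorem ordAt_neg (P : W.geomPoints) (u : W.geomFunctionField) : W.ordAt P (-u) = W.ordAt P u :=
  ord_neg P u

/-- At a pole of `u`, `ord_P (u - c) = ord_P u` for every constant `c`. [folklore] -/
theorem ordAt_sub_algebraMap_of_neg (P : W.geomPoints) {u : W.geomFunctionField}
    (hu : W.ordAt P u < 0) (c : AlgebraicClosure K) :
    W.ordAt P (u - algebraMap (AlgebraicClosure K) W.geomFunctionField c) = W.ordAt P u := by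
  have hu0 : u ≠ 0 := by rintro rfl; rw [ordAt_zero_right] at hu; exact lt_irrefl _ hu
  rcases eq_or_ne c 0 with rfl | hc
  · rw [map_zero, sub_zero]
  · have hc' : algebraMap (AlgebraicClosure K) W.geomFunctionField c ≠ 0 :=
      (_root_.map_ne_zero _).2 hc
    rw [ordAt_eq_ord_place P hu0] at hu ⊢
    have hlt : (W.place P).ord u < (W.place P).ord (-algebraMap _ W.geomFunctionField c) := by
      rw [PlaceOver.ord_neg, PlaceOver.ord_algebraMap_holds _ hc]; exact hu
    have h := (W.place P).ord_add_eq_left_of_lt hu0 (neg_ne_zero.2 hc') hlt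
    rw [← sub_eq_add_neg] at h
    rw [ordAt_eq_ord_place P h.1, h.2]

/-- `ord_O (x - e) = -2`. [cite: SilvermanAEC2009, III.§1] -/
theorem ordAt_zero_genX_sub (e : AlgebraicClosure K) :
    W.ordAt 0 (W.genX - algebraMap (AlgebraicClosure K) W.geomFunctionField e) = -2 := by
  rw [ordAt_sub_algebraMap_of_neg 0 (by rw [ordAt_zero_genX]; norm_num), ordAt_zero_genX]

omit [W.IsElliptic] in
/-- `K(u - c) = K(u)`. [folklore] -/
theorem adjoin_sub_algebraMap (u : W.geomFunctionField) (c : AlgebraicClosure K) :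
    (AlgebraicClosure K)⟮u - algebraMap (AlgebraicClosure K) W.geomFunctionField c⟯ =
      (AlgebraicClosure K)⟮u⟯ := by
  apply le_antisymm
  · rw [IntermediateField.adjoin_simple_le_iff]
    exact sub_mem (IntermediateField.mem_adjoin_simple_self _ u) (algebraMap_mem _ c)
  · rw [IntermediateField.adjoin_simple_le_iff]
    have h : u - algebraMap _ W.geomFunctionField c + algebraMap _ W.geomFunctionField c ∈
        (AlgebraicClosure K)⟮u - algebraMap (AlgebraicClosure K) W.geomFunctionField c⟯ :=
      add_mem (IntermediateField.mem_adjoin_simple_self _ _) (algebraMap_mem _ c)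
    rwa [sub_add_cancel] at h

/-- **`[K̄(E) : K̄(x - e)] = 2`** (`[K̄(E) : K̄(x)] = 2`, the pole of `x` being `O` of order `2`).
[cite: SilvermanAEC2009, Prop. III.3.1] -/
theorem finrank_adjoin_genX_sub (e : AlgebraicClosure K) :
    Module.finrank
      (AlgebraicClosure K)⟮W.genX - algebraMap (AlgebraicClosure K) W.geomFunctionField e⟯
      W.geomFunctionField = 2 := by
  rw [adjoin_sub_algebraMap]
  exact WeierstrassBelyi.finrank_adjoin_x (W.baseChange (AlgebraicClosure K)).toAffine

/-! ### Fibres consisting of a single place -/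

omit [W.IsElliptic] in
/-- **A fibre all of whose points have multiplicity `n = [F : K(y)]` is a single place**: if every
zero `P` of `y - a` has `v_P(y - a) = n = [F : K(y)] > 0` then `y - a` has exactly one zero
(`Σ_P v_P(y - a) = [F : K(y)]`, Stichtenoth Thm. 1.4.11). [cite: Stichtenoth2009, Thm. 1.4.11] -/
theorem existsUnique_zero_of_ord_eq {K' : Type u} {F : Type u} [Field K'] [Field F] [Algebra K' F]
    [IsAlgFunctionField K' F] [IsAlgClosed K'] {y : F} (hy : y ∉ Set.range (algebraMap K' F))
    (a : K') {n : ℕ} (hn : Module.finrank K'⟮y⟯ F = n) (hn0 : 0 < n)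
    (hall : ∀ P : PlaceOver K' F, 0 < P.ord (y - algebraMap K' F a) →
      P.ord (y - algebraMap K' F a) = n) :
    ∃ P : PlaceOver K' F, 0 < P.ord (y - algebraMap K' F a) ∧
      ∀ Q : PlaceOver K' F, 0 < Q.ord (y - algebraMap K' F a) → Q = P := by
  classical
  haveI := isIntegrallyClosedIn_of_isAlgClosed (K := K') (F := F)
  have hrat : ∀ P : PlaceOver K' F, P.IsRational := PlaceOver.isRational_of_isAlgClosed
  have hya : y - algebraMap K' F a ≠ 0 := fun h ↦ hy ⟨a, (sub_eq_zero.1 h).symm⟩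
  set U : Finset (PlaceOver K' F) := (finite_setOf_ord_ne_zero_holds (K := K') hya).toFinset.filter
    fun P ↦ 0 < P.ord (y - algebraMap K' F a) with hU
  have hmem : ∀ P, P ∈ U ↔ 0 < P.ord (y - algebraMap K' F a) := fun P ↦ by
    rw [hU, Finset.mem_filter, Set.Finite.mem_toFinset, Set.mem_setOf_eq]
    exact ⟨fun h ↦ h.2, fun h ↦ ⟨h.ne', h⟩⟩
  have hsum :=
    sum_ord_sub_eq_finrank hrat hy a U (fun P hP ↦ (hmem P).1 hP) fun P hP ↦ (hmem P).2 hP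
  rw [hn, Finset.sum_congr rfl fun P hP ↦ hall P ((hmem P).1 hP), Finset.sum_const,
    nsmul_eq_mul] at hsum
  have hcard : U.card = 1 := by
    have h : (U.card : ℤ) * n = 1 * n := by rw [one_mul]; exact hsum
    exact_mod_cast mul_right_cancel₀ (by exact_mod_cast hn0.ne' : (n : ℤ) ≠ 0) h
  obtain ⟨P, hP⟩ := Finset.card_eq_one.1 hcard
  refine ⟨P, (hmem P).1 (by rw [hP]; exact Finset.mem_singleton_self P), fun Q hQ ↦ ?_⟩
  have hQU : Q ∈ U := (hmem Q).2 hQ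
  rw [hP, Finset.mem_singleton] at hQU
  exact hQU

/-! ### A simple flex: `N_L = (X - e)³` -/

omit [W.IsElliptic] in
/-- The conjugate `ū = -y - a₁x - a₃ - (μx + κ)` of a line function is a regular function.
[folklore] -/
theorem conj_eq_algebraMap (μ κ : AlgebraicClosure K) :
    -W.genY - algebraMap _ W.geomFunctionField (W.baseChange (AlgebraicClosure K)).a₁ * W.genX -
        algebraMap _ W.geomFunctionField (W.baseChange (AlgebraicClosure K)).a₃ -
        (algebraMap _ W.geomFunctionField μ * W.genX + algebraMap _ W.geomFunctionField κ) =
      algebraMap (W.baseChange (AlgebraicClosure K)).toAffine.CoordinateRing W.geomFunctionField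
        (Affine.CoordinateRing.mk _
          (-(Y : (AlgebraicClosure K)[X][Y]) - C (C (W.baseChange (AlgebraicClosure K)).a₁ * X +
            C (W.baseChange (AlgebraicClosure K)).a₃) - C (C μ * X + C κ))) := by
  rw [EllipticCurves.WeierstrassFunctionField.algebraMap_mk]
  simp only [map_sub, map_neg, map_add, map_mul, aevalAeval_Y, aevalAeval_C, aeval_X, aeval_C,
    WeierstrassCurve.genX, WeierstrassCurve.genY]
  ring

/-- **A simple triple zero of a line function is a flex with cube `N_L = (X - e)³`.** If
`u = y - (μx + κ)` has `ord_P u ≥ 3` at an affine point `P = (e, b)` with `ord_P (x - e) = 1`, then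
the cubic `N_L = -u ū` (`line_mul_conj`) has `ord_P N_L(x) ≥ 3`, hence `N_L = (X - e)³`:
`a₂ - μ² - a₁μ = -3e` and `a₄ - 2μκ - a₁κ - a₃μ = 3e²`. [cite: SilvermanAEC2009, III.§1] -/
theorem coeffs_of_simple_zero {μ κ e b : AlgebraicClosure K}
    (h : (W.baseChange (AlgebraicClosure K)).toAffine.Nonsingular e b)
    (hu : 3 ≤ W.ordAt (.some e b h)
      (W.genY - (algebraMap _ W.geomFunctionField μ * W.genX + algebraMap _ W.geomFunctionField κ)))
    (hx : W.ordAt (.some e b h) (W.genX - algebraMap _ W.geomFunctionField e) = 1) :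
    (W.baseChange (AlgebraicClosure K)).a₂ - μ ^ 2 - (W.baseChange (AlgebraicClosure K)).a₁ * μ =
        -3 * e ∧
      (W.baseChange (AlgebraicClosure K)).a₄ - 2 * μ * κ -
          (W.baseChange (AlgebraicClosure K)).a₁ * κ - (W.baseChange (AlgebraicClosure K)).a₃ * μ =
        3 * e ^ 2 := by
  set P : W.geomPoints := .some e b h with hPdef
  set u := W.genY - (algebraMap (AlgebraicClosure K) W.geomFunctionField μ * W.genX +
    algebraMap (AlgebraicClosure K) W.geomFunctionField κ) with hudef
  set ubar := -W.genY -
    algebraMap (AlgebraicClosure K) W.geomFunctionField (W.baseChange (AlgebraicClosure K)).a₁ *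
      W.genX - algebraMap _ W.geomFunctionField (W.baseChange (AlgebraicClosure K)).a₃ -
    (algebraMap (AlgebraicClosure K) W.geomFunctionField μ * W.genX +
      algebraMap (AlgebraicClosure K) W.geomFunctionField κ) with hubar
  set A := (W.baseChange (AlgebraicClosure K)).a₂ - μ ^ 2 -
    (W.baseChange (AlgebraicClosure K)).a₁ * μ with hA
  set B := (W.baseChange (AlgebraicClosure K)).a₄ - 2 * μ * κ -
    (W.baseChange (AlgebraicClosure K)).a₁ * κ - (W.baseChange (AlgebraicClosure K)).a₃ * μ with hB
  set D := (W.baseChange (AlgebraicClosure K)).a₆ - κ ^ 2 -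
    (W.baseChange (AlgebraicClosure K)).a₃ * κ with hD
  set p : (AlgebraicClosure K)[X] := X ^ 3 + C A * X ^ 2 + C B * X + C D with hp
  have hP0 : P ≠ 0 := Affine.Point.some_ne_zero h
  have hu0 : u ≠ 0 := by
    intro h0; rw [h0, ordAt_zero_right] at hu; exact absurd hu (by norm_num)
  have hp0 : p ≠ 0 := fun h0 ↦ by
    have := congr_arg (fun q : (AlgebraicClosure K)[X] ↦ q.coeff 3) h0
    simp [hp] at this
  have hN : u * ubar = -aeval W.genX p :=
    line_mul_conj (W.baseChange (AlgebraicClosure K)) equation_gen μ κ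
  have hNp0 : aeval W.genX p ≠ 0 := fun h0 ↦ transcendental_genX W ⟨p, hp0, h0⟩
  have hubar0 : ubar ≠ 0 := by
    intro h0; rw [h0, mul_zero, eq_comm, neg_eq_zero] at hN; exact hNp0 hN
  -- `ord_P N(x) = ord_P u + ord_P ū ≥ 3`
  have hreg : 0 ≤ W.ordAt P ubar := by
    rw [hubar, conj_eq_algebraMap]; exact ordAt_algebraMap_nonneg hP0 _
  have hordN : 3 ≤ W.ordAt P (aeval W.genX p) := by
    have h1 : W.ordAt P (aeval W.genX p) = W.ordAt P u + W.ordAt P ubar := by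
      rw [← ordAt_neg, ← hN, ordAt_mul P hu0 hubar0]
    rw [h1]; omega
  -- through the place `W.place P`: `ord_P N(x) = mult_e(N) · ord_P (x - e)`
  have hx0 : W.genX - algebraMap (AlgebraicClosure K) W.geomFunctionField e ≠ 0 := fun h0 ↦
    transcendental_genX W ((sub_eq_zero.1 h0) ▸ isAlgebraic_algebraMap e)
  have hpos :
      0 < (W.place P).ord (W.genX - algebraMap (AlgebraicClosure K) W.geomFunctionField e) := by
    rw [← ordAt_eq_ord_place P hx0, hx]; exact one_pos
  obtain ⟨-, hmult⟩ := (W.place P).ord_aeval_of_ord_sub_pos hpos hp0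
  rw [← ordAt_eq_ord_place P hNp0, ← ordAt_eq_ord_place P hx0, hx, mul_one] at hmult
  rw [hmult] at hordN
  have h3 : 3 ≤ (p.comp (X + C e)).rootMultiplicity 0 := by exact_mod_cast hordN
  -- `X³ ∣ N(X + e)`, and the expansion of `N(X + e)`
  have hq0 : p.comp (X + C e) ≠ 0 := by
    intro h0
    rw [comp_eq_zero_iff] at h0
    rcases h0 with h0 | ⟨-, h0⟩
    · exact hp0 h0
    · have := congr_arg (fun q : (AlgebraicClosure K)[X] ↦ q.coeff 1) h0
      simp at this
  have hdvd : X ^ 3 ∣ p.comp (X + C e) := by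
    have := (le_rootMultiplicity_iff hq0).1 h3
    rwa [map_zero, sub_zero] at this
  have hexp : p.comp (X + C e) = X ^ 3 + C (3 * e + A) * X ^ 2 + C (3 * e ^ 2 + 2 * A * e + B) * X +
      C (e ^ 3 + A * e ^ 2 + B * e + D) := by
    rw [hp]
    simp only [add_comp, mul_comp, X_pow_comp, X_comp, C_comp, map_add, map_mul, map_pow,
      map_ofNat]
    ring
  have h2 := (X_pow_dvd_iff.1 hdvd) 2 (by norm_num)
  have h1 := (X_pow_dvd_iff.1 hdvd) 1 (by norm_num)
  rw [hexp] at h1 h2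
  simp only [coeff_add, coeff_C_mul, coeff_X_pow, coeff_X, coeff_C] at h1 h2
  norm_num at h1 h2
  exact ⟨by linear_combination h2, by linear_combination h1 - 2 * e * h2⟩

/-! ### A double zero of `x - e`: `2μ + a₁ = 0` -/

/-- **If the triple zero `P = (e, b)` of the line function `u = y - (μx + κ)` (divisor
`3P - 3O`) is a ramification point of `x` (`ord_P (x - e) = 2`), then `2μ + a₁ = 0` and
`2κ + a₃ = 0`**: `u²` and `(x - e)³` have the same divisor `6P - 6O`, so `u² = λ(x - e)³`
(`λ ∈ K̄ˣ`); expanding with the Weierstrass equation in the `K̄[x]`-basis `1, y` of `K̄[E]`, the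
`y`-component `-(2μ + a₁)x - (2κ + a₃)` vanishes. [cite: SilvermanAEC2009, Prop. III.3.1] -/
theorem slope_of_double_zero {μ κ e b : AlgebraicClosure K}
    (h : (W.baseChange (AlgebraicClosure K)).toAffine.Nonsingular e b)
    (hu0 : W.ordAt 0 (W.genY -
      (algebraMap _ W.geomFunctionField μ * W.genX + algebraMap _ W.geomFunctionField κ)) = -3)
    (huP : W.ordAt (.some e b h) (W.genY -
      (algebraMap _ W.geomFunctionField μ * W.genX + algebraMap _ W.geomFunctionField κ)) = 3)
    (huR : ∀ R : W.geomPoints, R ≠ 0 → R ≠ .some e b h → W.ordAt R (W.genY -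
      (algebraMap _ W.geomFunctionField μ * W.genX + algebraMap _ W.geomFunctionField κ)) = 0)
    (hxP : W.ordAt (.some e b h) (W.genX - algebraMap _ W.geomFunctionField e) = 2)
    (hxR : ∀ R : W.geomPoints, R ≠ 0 → R ≠ .some e b h →
      W.ordAt R (W.genX - algebraMap _ W.geomFunctionField e) = 0) :
    2 * μ + (W.baseChange (AlgebraicClosure K)).a₁ = 0 ∧
      2 * κ + (W.baseChange (AlgebraicClosure K)).a₃ = 0 := by
  set P : W.geomPoints := .some e b h with hPdef
  set u := W.genY - (algebraMap (AlgebraicClosure K) W.geomFunctionField μ * W.genX +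
    algebraMap (AlgebraicClosure K) W.geomFunctionField κ) with hudef
  have hune : u ≠ 0 := by
    intro h0; rw [h0, ordAt_zero_right] at huP; exact absurd huP (by norm_num)
  have hxne : W.genX - algebraMap (AlgebraicClosure K) W.geomFunctionField e ≠ 0 := fun h0 ↦
    transcendental_genX W ((sub_eq_zero.1 h0) ▸ isAlgebraic_algebraMap e)
  have hall : ∀ R : W.geomPoints, W.ordAt R (u ^ 2) =
      W.ordAt R ((W.genX - algebraMap (AlgebraicClosure K) W.geomFunctionField e) ^ 3) := by
    intro R
    rw [pow_two, ordAt_mul R hune hune, pow_succ, pow_two, ordAt_mul R (mul_ne_zero hxne hxne) hxne,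
      ordAt_mul R hxne hxne]
    by_cases hR0 : R = 0
    · rw [hR0, hu0, ordAt_zero_genX_sub]; norm_num
    · by_cases hRP : R = P
      · rw [hRP, hPdef, huP, hxP]; norm_num
      · rw [huR R hR0 hRP, hxR R hR0 hRP]; norm_num
  obtain ⟨l, -, hl⟩ := exists_eq_smul_of_ordAt_eq (pow_ne_zero 2 hune) (pow_ne_zero 3 hxne) hall
  rw [Algebra.smul_def] at hl
  have hl' : u ^ 2 - algebraMap (AlgebraicClosure K) W.geomFunctionField l *
      (W.genX - algebraMap (AlgebraicClosure K) W.geomFunctionField e) ^ 3 = 0 := sub_eq_zero.2 hl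
  have heq := equation_gen (W := W)
  have key : algebraMap _ W.geomFunctionField ((W.baseChange (AlgebraicClosure K)).a₆ + κ ^ 2 +
        l * e ^ 3) +
      algebraMap _ W.geomFunctionField ((W.baseChange (AlgebraicClosure K)).a₄ + 2 * μ * κ -
        3 * l * e ^ 2) * W.genX +
      algebraMap _ W.geomFunctionField ((W.baseChange (AlgebraicClosure K)).a₂ + μ ^ 2 +
        3 * l * e) * W.genX ^ 2 +
      algebraMap (AlgebraicClosure K) W.geomFunctionField (1 - l) * W.genX ^ 3 +
      (algebraMap _ W.geomFunctionField (-(2 * κ + (W.baseChange (AlgebraicClosure K)).a₃)) +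
        algebraMap _ W.geomFunctionField (-(2 * μ + (W.baseChange (AlgebraicClosure K)).a₁)) *
          W.genX) * W.genY = 0 := by
    simp only [map_add, map_sub, map_mul, map_neg, map_pow, map_ofNat, map_one]
    rw [hudef] at hl'
    linear_combination hl' - heq
  obtain ⟨-, -, -, -, hQ₀, hQ₁⟩ := coeffs_eq_zero_of_lin_eq_zero key
  exact ⟨neg_eq_zero.1 hQ₁, neg_eq_zero.1 hQ₀⟩

/-! ### The zeros of `x - e`: simple, or a single double zero -/

/-- **`ord_P (x - e) ∈ {1, 2}` at `P = (e, b)`, and if it is `2` then `x - e` vanishes nowhere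
else** (`Σ_R ord_R (x - e) = [K̄(E) : K̄(x)] = 2`). [cite: SilvermanAEC2009, Prop. II.2.6(a)] -/
theorem ordAt_genX_sub_cases {e b : AlgebraicClosure K}
    (h : (W.baseChange (AlgebraicClosure K)).toAffine.Nonsingular e b) :
    W.ordAt (.some e b h) (W.genX - algebraMap _ W.geomFunctionField e) = 1 ∨
      (W.ordAt (.some e b h) (W.genX - algebraMap _ W.geomFunctionField e) = 2 ∧
        ∀ R : W.geomPoints, R ≠ 0 → R ≠ .some e b h →
          W.ordAt R (W.genX - algebraMap _ W.geomFunctionField e) = 0) := by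
  classical
  haveI := isIntegrallyClosedIn_of_isAlgClosed (K := AlgebraicClosure K) (F := W.geomFunctionField)
  have hrat : ∀ P : PlaceOver (AlgebraicClosure K) W.geomFunctionField, P.IsRational :=
    PlaceOver.isRational_of_isAlgClosed
  have hpos := ordAt_genX_sub_pos (W := W) h
  set P : W.geomPoints := .some e b h with hPdef
  have hP0 : P ≠ 0 := Affine.Point.some_ne_zero h
  have hxK : W.genX ∉ Set.range (algebraMap (AlgebraicClosure K) W.geomFunctionField) := by
    rintro ⟨c, hc⟩
    exact transcendental_genX W (hc ▸ isAlgebraic_algebraMap c)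
  have hx0 : W.genX - algebraMap (AlgebraicClosure K) W.geomFunctionField e ≠ 0 := fun h0 ↦
    hxK ⟨e, (sub_eq_zero.1 h0).symm⟩
  -- the zeros of `x - e`, as places
  set U : Finset (PlaceOver (AlgebraicClosure K) W.geomFunctionField) :=
    (finite_setOf_ord_ne_zero_holds (K := AlgebraicClosure K) hx0).toFinset.filter
      fun Q ↦ 0 < Q.ord (W.genX - algebraMap _ W.geomFunctionField e) with hU
  have hmem : ∀ Q, Q ∈ U ↔ 0 < Q.ord (W.genX - algebraMap _ W.geomFunctionField e) := fun Q ↦ by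
    rw [hU, Finset.mem_filter, Set.Finite.mem_toFinset, Set.mem_setOf_eq]
    exact ⟨fun h ↦ h.2, fun h ↦ ⟨h.ne', h⟩⟩
  have hsum := sum_ord_sub_eq_finrank hrat hxK e U (fun Q hQ ↦ (hmem Q).1 hQ)
    fun Q hQ ↦ (hmem Q).2 hQ
  have hfin : Module.finrank (AlgebraicClosure K)⟮W.genX⟯ W.geomFunctionField = 2 :=
    WeierstrassBelyi.finrank_adjoin_x (W.baseChange (AlgebraicClosure K)).toAffine
  rw [hfin] at hsum
  have hPU : W.place P ∈ U := (hmem _).2 (by rwa [← ordAt_eq_ord_place P hx0])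
  have hsplit := Finset.sum_erase_add U
    (fun Q ↦ Q.ord (W.genX - algebraMap _ W.geomFunctionField e)) hPU
  rw [hsum, ← ordAt_eq_ord_place P hx0] at hsplit
  have hrest : 0 ≤ ∑ Q ∈ U.erase (W.place P),
      Q.ord (W.genX - algebraMap _ W.geomFunctionField e) :=
    Finset.sum_nonneg fun Q hQ ↦ ((hmem Q).1 (Finset.mem_of_mem_erase hQ)).le
  have hle : W.ordAt P (W.genX - algebraMap _ W.geomFunctionField e) ≤ 2 := by
    push_cast at hsplit; omega
  rcases (show W.ordAt P (W.genX - algebraMap _ W.geomFunctionField e) = 1 ∨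
      W.ordAt P (W.genX - algebraMap _ W.geomFunctionField e) = 2 by omega) with h1 | h2
  · exact Or.inl h1
  · refine Or.inr ⟨h2, fun R hR0 hRP ↦ ?_⟩
    -- the other zeros carry total multiplicity `0`
    have hzero : ∑ Q ∈ U.erase (W.place P),
        Q.ord (W.genX - algebraMap _ W.geomFunctionField e) = 0 := by
      rw [h2] at hsplit; push_cast at hsplit; omega
    have hnot : ¬ 0 < W.ordAt R (W.genX - algebraMap _ W.geomFunctionField e) := by
      intro hR
      have hRU : W.place R ∈ U := (hmem _).2 (by rwa [← ordAt_eq_ord_place R hx0])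
      have hne : W.place R ≠ W.place P := fun he ↦ hRP (place_injective he)
      have hmemE : W.place R ∈ U.erase (W.place P) := Finset.mem_erase.2 ⟨hne, hRU⟩
      have hlt : 0 < ∑ Q ∈ U.erase (W.place P),
          Q.ord (W.genX - algebraMap _ W.geomFunctionField e) :=
        Finset.sum_pos' (fun Q hQ ↦ ((hmem Q).1 (Finset.mem_of_mem_erase hQ)).le)
          ⟨W.place R, hmemE, (hmem _).1 hRU⟩
      omega
    have hge : 0 ≤ W.ordAt R (W.genX - algebraMap _ W.geomFunctionField e) := by
      rw [genX_sub_algebraMap]; exact ordAt_algebraMap_nonneg hR0 _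
    omega

/-! ### Degree-`3` Belyi functions with pole at `O` -/

section CharZero

variable [CharZero K]

/-- The three special fibres of a degree-`3` Belyi function on `K̄(E)` are triple points
(`IsBelyiFunction.ord_eq_three_of_finrank_eq_three` for `K̄(E)`, genus one). [cite:
Javanpeykar2014, Lemma 3.2.2] -/
theorem ord_eq_three {f : W.geomFunctionField} (hf : IsBelyiFunction (AlgebraicClosure K) f)
    (hd : Module.finrank (AlgebraicClosure K)⟮f⟯ W.geomFunctionField = 3) :
    (∀ P : PlaceOver (AlgebraicClosure K) W.geomFunctionField, 0 < P.ord f → P.ord f = 3) ∧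
      (∀ P : PlaceOver (AlgebraicClosure K) W.geomFunctionField,
        0 < P.ord (f - 1) → P.ord (f - 1) = 3) ∧
      ∀ P : PlaceOver (AlgebraicClosure K) W.geomFunctionField, P.ord f < 0 → P.ord f = -3 := by
  haveI : CharZero (AlgebraicClosure K) :=
    charZero_of_injective_algebraMap (algebraMap K (AlgebraicClosure K)).injective
  exact hf.ord_eq_three_of_finrank_eq_three
    (genus_functionField_weierstrass_holds _ (W.baseChange (AlgebraicClosure K)).toAffine) hd

/-- **The pole of a degree-`3` Belyi function is a single point `S`** (`ord_S f = -3`, no other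
poles). [cite: Javanpeykar2014, Lemma 3.2.2] -/
theorem exists_pole_point {f : W.geomFunctionField} (hf : IsBelyiFunction (AlgebraicClosure K) f)
    (hd : Module.finrank (AlgebraicClosure K)⟮f⟯ W.geomFunctionField = 3) :
    ∃ S : W.geomPoints, W.ordAt S f = -3 ∧ ∀ R : W.geomPoints, R ≠ S → 0 ≤ W.ordAt R f := by
  obtain ⟨-, -, hi⟩ := ord_eq_three hf hd
  have hf0 : f ≠ 0 := fun h0 ↦ hf.1 ⟨0, by rw [map_zero, h0]⟩
  have hfi : f⁻¹ ∉ Set.range (algebraMap (AlgebraicClosure K) W.geomFunctionField) := by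
    rintro ⟨c, hc⟩
    exact hf.1 ⟨c⁻¹, by rw [map_inv₀, hc, inv_inv]⟩
  have hdi : Module.finrank (AlgebraicClosure K)⟮f⁻¹⟯ W.geomFunctionField = 3 := by
    have h := adjoin_inv_sub_algebraMap_eq f (0 : AlgebraicClosure K)
    rw [map_zero, sub_zero] at h
    rw [h, hd]
  have hall : ∀ P : PlaceOver (AlgebraicClosure K) W.geomFunctionField,
      0 < P.ord (f⁻¹ - algebraMap (AlgebraicClosure K) W.geomFunctionField 0) →
        P.ord (f⁻¹ - algebraMap (AlgebraicClosure K) W.geomFunctionField 0) = (3 : ℕ) := by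
    intro P hP
    rw [map_zero, sub_zero, PlaceOver.ord_inv _ hf0] at hP ⊢
    have := hi P (by omega)
    push_cast; omega
  obtain ⟨P, hP, huniq⟩ := existsUnique_zero_of_ord_eq hfi 0 hdi (by norm_num) hall
  rw [map_zero, sub_zero] at hP huniq
  obtain ⟨S, rfl⟩ := place_surjective (W := W) P
  refine ⟨S, ?_, fun R hRS ↦ ?_⟩
  · rw [PlaceOver.ord_inv _ hf0] at hP
    rw [ordAt_eq_ord_place S hf0]
    exact hi _ (by omega)
  · by_contra hneg
    have hR : 0 < (W.place R).ord f⁻¹ := by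
      rw [PlaceOver.ord_inv _ hf0, ← ordAt_eq_ord_place R hf0]; omega
    exact hRS (place_injective (huniq _ hR))

/-- **The zero of `f - c'` (`c' ∈ {0, 1}`) of a degree-`3` Belyi function with pole at `O` is a
single affine point of multiplicity `3`.** [cite: Javanpeykar2014, Lemma 3.2.2] -/
theorem exists_zero_point {f : W.geomFunctionField} (hf : IsBelyiFunction (AlgebraicClosure K) f)
    (hd : Module.finrank (AlgebraicClosure K)⟮f⟯ W.geomFunctionField = 3) (hpole : W.ordAt 0 f = -3)
    (hreg : ∀ R : W.geomPoints, R ≠ 0 → 0 ≤ W.ordAt R f) {c' : AlgebraicClosure K}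
    (hc' : c' = 0 ∨ c' = 1) :
    ∃ (e b : AlgebraicClosure K) (h : (W.baseChange (AlgebraicClosure K)).toAffine.Nonsingular e b),
      W.ordAt (.some e b h) (f - algebraMap _ W.geomFunctionField c') = 3 ∧
        ∀ R : W.geomPoints, R ≠ 0 → R ≠ .some e b h →
          W.ordAt R (f - algebraMap _ W.geomFunctionField c') = 0 := by
  obtain ⟨h0, h1, -⟩ := ord_eq_three hf hd
  have hfc : f - algebraMap _ W.geomFunctionField c' ≠ 0 := fun h ↦
    hf.1 ⟨c', (sub_eq_zero.1 h).symm⟩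
  have hall : ∀ P : PlaceOver (AlgebraicClosure K) W.geomFunctionField,
      0 < P.ord (f - algebraMap _ W.geomFunctionField c') →
        P.ord (f - algebraMap _ W.geomFunctionField c') = (3 : ℕ) := by
    intro P hP
    rcases hc' with rfl | rfl
    · rw [map_zero, sub_zero] at hP ⊢; exact_mod_cast h0 P hP
    · rw [map_one] at hP ⊢; exact_mod_cast h1 P hP
  obtain ⟨P, hP, huniq⟩ := existsUnique_zero_of_ord_eq hf.1 c' hd (by norm_num) hall
  obtain ⟨Q, rfl⟩ := place_surjective (W := W) P
  -- `Q ≠ O` since `f - c'` has a pole at `O`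
  have hQ0 : Q ≠ 0 := by
    rintro rfl
    have h := ordAt_sub_algebraMap_of_neg (W := W) 0 (u := f) (by rw [hpole]; norm_num) c'
    rw [ordAt_eq_ord_place 0 hfc, hpole] at h
    omega
  obtain ⟨e, b, h, rfl⟩ := geomPoints.exists_eq_some hQ0
  refine ⟨e, b, h, ?_, fun R hR0 hRQ ↦ ?_⟩
  · rw [ordAt_eq_ord_place _ hfc]; exact_mod_cast hall _ hP
  · have hf0 : f ≠ 0 := fun h0 ↦ hf.1 ⟨0, by rw [map_zero, h0]⟩
    have hge : 0 ≤ W.ordAt R (f - algebraMap _ W.geomFunctionField c') := by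
      rw [ordAt_eq_ord_place R hfc]
      refine PlaceOver.ord_nonneg_of_mem _ (sub_mem ?_ ((W.place R).algebraMap_mem c'))
      exact ((W.place R).mem_toValuationSubring_iff_ord_nonneg hf0).2
        (by rw [← ordAt_eq_ord_place R hf0]; exact hreg R hR0)
    have hnot : ¬ 0 < W.ordAt R (f - algebraMap _ W.geomFunctionField c') := fun hlt ↦ by
      rw [ordAt_eq_ord_place R hfc] at hlt
      exact hRQ (place_injective (huniq _ hlt))
    omega

/-- **`c₄ = 0` for a degree-`3` Belyi function with pole at `O`.** [cite: Zapponi2009BelyiDegree,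
Example 1.2] -/
theorem c₄_eq_zero_of_pole_zero {f : W.geomFunctionField}
    (hf : IsBelyiFunction (AlgebraicClosure K) f)
    (hd : Module.finrank (AlgebraicClosure K)⟮f⟯ W.geomFunctionField = 3)
    (hpole : W.ordAt 0 f = -3) : (W.baseChange (AlgebraicClosure K)).c₄ = 0 := by
  haveI : CharZero (AlgebraicClosure K) :=
    charZero_of_injective_algebraMap (algebraMap K (AlgebraicClosure K)).injective
  have hf0 : f ≠ 0 := fun h0 ↦ hf.1 ⟨0, by rw [map_zero, h0]⟩
  -- no affine poles
  obtain ⟨S, hS, hregS⟩ := exists_pole_point hf hd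
  have hS0 : S = 0 := by
    by_contra hS0
    have := hregS 0 (Ne.symm hS0)
    omega
  subst hS0
  have hreg : ∀ R : W.geomPoints, R ≠ 0 → 0 ≤ W.ordAt R f := hregS
  -- `f = a + b x + c y`, `c ≠ 0`
  obtain ⟨a, b, c, hfabc, -, hc3⟩ := exists_eq_lin_of_ordAt hf0 hreg (by rw [hpole])
  have hc : c ≠ 0 := hc3 hpole
  -- the line functions `u_{c'} = c⁻¹ (f - c') = y - (μ x + κ_{c'})`
  set μ : AlgebraicClosure K := -b / c with hμ
  have hline : ∀ c' : AlgebraicClosure K,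
      W.genY - (algebraMap _ W.geomFunctionField μ * W.genX +
        algebraMap _ W.geomFunctionField ((c' - a) / c)) =
      algebraMap _ W.geomFunctionField c⁻¹ * (f - algebraMap _ W.geomFunctionField c') := by
    intro c'
    have hcF : algebraMap (AlgebraicClosure K) W.geomFunctionField c ≠ 0 :=
      (_root_.map_ne_zero _).2 hc
    rw [hfabc, hμ]
    simp only [map_div₀, map_neg, map_sub, map_inv₀]
    field_simp
    ring
  have hordu : ∀ (c' : AlgebraicClosure K) (R : W.geomPoints),
      W.ordAt R (W.genY - (algebraMap _ W.geomFunctionField μ * W.genX +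
        algebraMap _ W.geomFunctionField ((c' - a) / c))) =
      W.ordAt R (f - algebraMap _ W.geomFunctionField c') := fun c' R ↦ by
    rw [hline, ordAt_algebraMap_mul R (inv_ne_zero hc)]
  have hu0 : ∀ c' : AlgebraicClosure K, W.ordAt 0 (W.genY - (algebraMap _ W.geomFunctionField μ *
      W.genX + algebraMap _ W.geomFunctionField ((c' - a) / c))) = -3 := fun c' ↦ by
    rw [hordu, ordAt_sub_algebraMap_of_neg 0 (by rw [hpole]; norm_num), hpole]
  -- the data at the two zeros
  have hdata : ∀ c' : AlgebraicClosure K, c' = 0 ∨ c' = 1 →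
      (2 * μ + (W.baseChange (AlgebraicClosure K)).a₁ = 0 ∧
        2 * ((c' - a) / c) + (W.baseChange (AlgebraicClosure K)).a₃ = 0) ∨
      ∃ e : AlgebraicClosure K,
        (W.baseChange (AlgebraicClosure K)).a₂ - μ ^ 2 -
            (W.baseChange (AlgebraicClosure K)).a₁ * μ = -3 * e ∧
          (W.baseChange (AlgebraicClosure K)).a₄ - 2 * μ * ((c' - a) / c) -
              (W.baseChange (AlgebraicClosure K)).a₁ * ((c' - a) / c) -
              (W.baseChange (AlgebraicClosure K)).a₃ * μ = 3 * e ^ 2 := by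
    intro c' hc'
    obtain ⟨e, b', h, hP3, hPR⟩ := exists_zero_point hf hd hpole hreg hc'
    rcases ordAt_genX_sub_cases (W := W) h with hx1 | ⟨hx2, hxR⟩
    · right
      exact ⟨e, coeffs_of_simple_zero h (by rw [hordu, hP3]) hx1⟩
    · left
      exact slope_of_double_zero h (hu0 c') (by rw [hordu, hP3])
        (fun R hR0 hRP ↦ by rw [hordu, hPR R hR0 hRP]) hx2 hxR
  rcases hdata 0 (Or.inl rfl) with ⟨hμ0, hκ0⟩ | ⟨e₀, h2₀, h1₀⟩ <;>
    rcases hdata 1 (Or.inr rfl) with ⟨hμ1, hκ1⟩ | ⟨e₁, h2₁, h1₁⟩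
  · -- double/double: `κ₀ = κ₁`, absurd
    exfalso
    have h01 : (0 - a) / c = (1 - a) / c := by linear_combination (hκ0 - hκ1) / 2
    field_simp at h01
    exact one_ne_zero (by linear_combination -h01)
  · exact c₄_eq_zero_of_cube _ hμ0 h2₁ h1₁
  · exact c₄_eq_zero_of_cube _ hμ1 h2₀ h1₀
  · have hκ : (0 - a) / c ≠ (1 - a) / c := by
      intro h01
      field_simp at h01
      exact one_ne_zero (by linear_combination -h01)
    exact c₄_eq_zero_of_cube _ (two_mul_add_a₁_eq_zero_of_cubes _ hκ h2₀ h2₁ h1₀ h1₁) h2₀ h1₀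

/-! ### The general case: translate the pole to `O` -/

/-- **`c₄ = 0` for an elliptic curve with a degree-`3` Belyi function** (the pole `S` of `f` is
moved to `O` by the translation `τ_S^*`). [cite: Zapponi2009BelyiDegree, Example 1.2] -/
theorem c₄_eq_zero_of_finrank_eq_three {f : W.geomFunctionField}
    (hf : IsBelyiFunction (AlgebraicClosure K) f)
    (hd : Module.finrank (AlgebraicClosure K)⟮f⟯ W.geomFunctionField = 3) :
    (W.baseChange (AlgebraicClosure K)).c₄ = 0 := by
  obtain ⟨S, hS, -⟩ := exists_pole_point hf hd
  set f' : W.geomFunctionField := W.transAlgEquiv S f with hf'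
  have hf'B : IsBelyiFunction (AlgebraicClosure K) f' := hf.map_algEquiv (W.transAlgEquiv S)
  have hd' : Module.finrank (AlgebraicClosure K)⟮f'⟯ W.geomFunctionField = 3 := by
    rw [hf', finrank_adjoin_map_algEquiv, hd]
  have hpole : W.ordAt 0 f' = -3 := by
    rw [hf', transAlgEquiv_apply, ordAt_transAlgHom, zero_add, hS]
  exact c₄_eq_zero_of_pole_zero hf'B hd' hpole

end CharZero

end FunctionField




end BelyiDegreeThreeJZero

/-! ### The theorems -/

open BelyiDegreeThreeJZero

variable {K : Type u} [Field K] [CharZero K] (W : WeierstrassCurve K) [W.IsElliptic]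

/-- **An elliptic curve with a Belyi function of degree `3` has `j = 0`** (`E/K`, `char K = 0`,
Belyi functions of the function field `K̄(E)` over `K̄ = AlgebraicClosure K`).
[cite: Zapponi2009BelyiDegree, Example 1.2] -/
theorem j_eq_zero_of_isBelyiFunction_of_finrank_eq_three {f : W.geomFunctionField}
    (hf : IsBelyiFunction (AlgebraicClosure K) f)
    (hd : Module.finrank (AlgebraicClosure K)⟮f⟯ W.geomFunctionField = 3) : W.j = 0 := by
  have h := c₄_eq_zero_of_finrank_eq_three hf hd
  rw [WeierstrassCurve.baseChange, WeierstrassCurve.map_c₄, map_eq_zero] at h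
  exact WeierstrassCurve.j_eq_zero W h

/-- **`deg_B(E) = 3 ⇒ j(E) = 0`**: "There is a unique isomorphism class of curves of Belyi degree
`3`, corresponding to the elliptic curves with `j`-invariant `0`" (the converse,
`deg_B(y² = x³ + B) = 3`, is `WeierstrassBelyi.belyiDegree_eq_three` of `BelyiDegreeThree`).
[cite: Zapponi2009BelyiDegree, Example 1.2] -/
theorem j_eq_zero_of_belyiDegree_eq_three
    (h3 : belyiDegree (AlgebraicClosure K) W.geomFunctionField = 3) : W.j = 0 := by
  have hex : ∃ f : W.geomFunctionField, IsBelyiFunction (AlgebraicClosure K) f := by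
    by_contra hne
    push Not at hne
    rw [belyiDegree_eq_zero_of_forall_not hne] at h3
    exact absurd h3 (by norm_num)
  obtain ⟨f, hf, hfd⟩ := exists_finrank_eq_belyiDegree hex
  exact j_eq_zero_of_isBelyiFunction_of_finrank_eq_three W hf (hfd.trans h3)

/-- Contrapositive: **`j(E) ≠ 0 ⇒ deg_B(E) ≠ 3`.** [cite: Zapponi2009BelyiDegree, Example 1.2] -/
theorem belyiDegree_ne_three_of_j_ne_zero (hj : W.j ≠ 0) :
    belyiDegree (AlgebraicClosure K) W.geomFunctionField ≠ 3 := fun h3 ↦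
  hj (j_eq_zero_of_belyiDegree_eq_three W h3)

/-- **`deg_B(y² = x³ + A x) = 4`** (`j = 1728`): `3 ≤ deg_B ≤ 4` by the Belyi function `-x²/A`
(`WeierstrassBelyi.belyiDegree_j1728`), and `deg_B ≠ 3` since `c₄ = -48 A ≠ 0`. Zapponi: "There are
two isomorphism classes of elliptic curves with Belyi degree `4`, corresponding to `j = 1728` and
`j = 207646/6561`." [cite: Zapponi2009BelyiDegree, Example 1.2] -/
theorem belyiDegree_j1728_eq_four (h₁ : W.a₁ = 0) (h₂ : W.a₂ = 0) (h₃ : W.a₃ = 0) (h₆ : W.a₆ = 0) :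
    belyiDegree (AlgebraicClosure K) W.geomFunctionField = 4 := by
  haveI : CharZero (AlgebraicClosure K) :=
    charZero_of_injective_algebraMap (algebraMap K (AlgebraicClosure K)).injective
  haveI : (W.baseChange (AlgebraicClosure K)).IsElliptic := by
    rw [WeierstrassCurve.baseChange]; infer_instance
  obtain ⟨h3, h4⟩ := WeierstrassBelyi.belyiDegree_j1728 (W.baseChange (AlgebraicClosure K)).toAffine
    (by simp [WeierstrassCurve.baseChange, h₁]) (by simp [WeierstrassCurve.baseChange, h₂])
    (by simp [WeierstrassCurve.baseChange, h₃]) (by simp [WeierstrassCurve.baseChange, h₆])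
  have hj : W.j ≠ 0 := by
    have ha₄ : W.a₄ ≠ 0 := by
      intro h4
      apply W.isUnit_Δ.ne_zero
      simp only [WeierstrassCurve.Δ, WeierstrassCurve.b₂, WeierstrassCurve.b₄, WeierstrassCurve.b₆,
        WeierstrassCurve.b₈, h₁, h₂, h₃, h4, h₆]
      ring
    rw [Ne, WeierstrassCurve.j_eq_zero_iff, WeierstrassCurve.c₄, WeierstrassCurve.b₂,
      WeierstrassCurve.b₄, h₁, h₂, h₃]
    intro h0
    apply ha₄
    have : (48 : K) * W.a₄ = 0 := by linear_combination -h0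
    exact (mul_eq_zero.1 this).resolve_left (by norm_num)
  have hne := belyiDegree_ne_three_of_j_ne_zero W hj
  change 3 ≤ belyiDegree (AlgebraicClosure K) W.geomFunctionField at h3
  change belyiDegree (AlgebraicClosure K) W.geomFunctionField ≤ 4 at h4
  omega

/-- **In the setting of `javanpeykar2014_stableFaltingsHeight_le`** (`E/K` over a number field,
`Ω = K̄`): if `j(E) ≠ 0` then `deg_B(E_Ω) ≥ 4`, so Javanpeykar's bound reads
`h_F(E) ≤ 13·10⁶ · deg_B(E_Ω)⁵` with `deg_B(E_Ω)⁵ ≥ 1024` (`deg_B ≥ 3` unconditionally,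
`three_le_belyiDegree_baseChange`). [cite: Javanpeykar2014, Thm. 1.1.1] -/
theorem four_le_belyiDegree_of_j_ne_zero (K : Type) [Field K] [NumberField K]
    (W : WeierstrassCurve K) [W.IsElliptic] (hj : W.j ≠ 0) :
    4 ≤ belyiDegree (AlgebraicClosure K) W.geomFunctionField := by
  have h3 := three_le_belyiDegree_baseChange K W (AlgebraicClosure K)
  change 3 ≤ belyiDegree (AlgebraicClosure K) W.geomFunctionField at h3
  have hne := belyiDegree_ne_three_of_j_ne_zero W hj
  omega

/-! ### `deg_B` only depends on `j`; `deg_B(E) = 3 ↔ j(E) = 0` (appended) -/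

section Models

variable {K : Type u} [Field K] [CharZero K]

/-- **The Belyi degree of `K̄(E)` is invariant under admissible changes of variables** (the
function fields are `K̄`-isomorphic, `variableChangeAlgEquiv`; `belyiDegree_eq_of_algEquiv`).
[cite: Javanpeykar2014, §1.1] -/
theorem belyiDegree_smul_eq {k : Type u} [Field k] (V : WeierstrassCurve k) [V.IsElliptic]
    (C : WeierstrassCurve.VariableChange k) :
    belyiDegree k (C • V).toAffine.FunctionField = belyiDegree k V.toAffine.FunctionField :=
  belyiDegree_eq_of_algEquiv
    (EllipticCurves.WeierstrassFunctionField.variableChangeAlgEquiv V C)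

omit [CharZero K] in
/-- **`deg_B(E_{K̄})` only depends on `j(E)`**: elliptic curves over `K` (`char K = 0`) with the
same `j`-invariant have the same Belyi degree over `K̄ = AlgebraicClosure K` (they become isomorphic
over `K̄`, Mathlib's `exists_variableChange_of_j_eq`).
[cite: Zapponi2009BelyiDegree, Example 1.2] -/
theorem belyiDegree_eq_of_j_eq (W W' : WeierstrassCurve K) [W.IsElliptic] [W'.IsElliptic]
    (hj : W.j = W'.j) :
    belyiDegree (AlgebraicClosure K) W.geomFunctionField =
      belyiDegree (AlgebraicClosure K) W'.geomFunctionField := by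
  haveI : (W.baseChange (AlgebraicClosure K)).IsElliptic := by
    rw [WeierstrassCurve.baseChange]; infer_instance
  haveI : (W'.baseChange (AlgebraicClosure K)).IsElliptic := by
    rw [WeierstrassCurve.baseChange]; infer_instance
  have hj' : (W.baseChange (AlgebraicClosure K)).j = (W'.baseChange (AlgebraicClosure K)).j := by
    simp only [WeierstrassCurve.baseChange, WeierstrassCurve.map_j, hj]
  obtain ⟨C, hC⟩ := WeierstrassCurve.exists_variableChange_of_j_eq _ _ hj'
  have h := belyiDegree_smul_eq (W.baseChange (AlgebraicClosure K)) C
  rw [hC] at h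
  exact h.symm

/-- **`j(E) = 0 ⇒ deg_B(E) = 3`** for every model: reduce to `y² = x³ + 1`
(`WeierstrassBelyi.belyiDegree_eq_three`) by `belyiDegree_eq_of_j_eq`.
[cite: Zapponi2009BelyiDegree, Example 1.2] -/
theorem belyiDegree_eq_three_of_j_eq_zero (W : WeierstrassCurve K) [W.IsElliptic] (hj : W.j = 0) :
    belyiDegree (AlgebraicClosure K) W.geomFunctionField = 3 := by
  haveI : CharZero (AlgebraicClosure K) :=
    charZero_of_injective_algebraMap (algebraMap K (AlgebraicClosure K)).injective
  -- the model `E₀ : y² = x³ + 1` over `K`, `j(E₀) = 0`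
  let E₀ : WeierstrassCurve K := ⟨0, 0, 0, 0, 1⟩
  haveI hE : E₀.IsElliptic := ⟨by
    rw [isUnit_iff_ne_zero]
    simp only [WeierstrassCurve.Δ, WeierstrassCurve.b₂, WeierstrassCurve.b₄, WeierstrassCurve.b₆,
      WeierstrassCurve.b₈, E₀]
    norm_num⟩
  have hj₀ : E₀.j = 0 := WeierstrassCurve.j_eq_zero E₀ (by
    simp only [WeierstrassCurve.c₄, WeierstrassCurve.b₂, WeierstrassCurve.b₄, E₀]; norm_num)
  rw [belyiDegree_eq_of_j_eq W E₀ (hj.trans hj₀.symm)]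
  haveI : (E₀.baseChange (AlgebraicClosure K)).IsElliptic := by
    rw [WeierstrassCurve.baseChange]; infer_instance
  exact WeierstrassBelyi.belyiDegree_eq_three (E₀.baseChange (AlgebraicClosure K)).toAffine
    (by simp [WeierstrassCurve.baseChange, E₀]) (by simp [WeierstrassCurve.baseChange, E₀])
    (by simp [WeierstrassCurve.baseChange, E₀]) (by simp [WeierstrassCurve.baseChange, E₀])

/-- **Zapponi's Example 1.2 for elliptic curves: `deg_B(E) = 3 ↔ j(E) = 0`** (`E/K`,
`char K = 0`, Belyi degree of `K̄(E)` over `K̄ = AlgebraicClosure K`).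
[cite: Zapponi2009BelyiDegree, Example 1.2] -/
theorem belyiDegree_eq_three_iff_j_eq_zero (W : WeierstrassCurve K) [W.IsElliptic] :
    belyiDegree (AlgebraicClosure K) W.geomFunctionField = 3 ↔ W.j = 0 :=
  ⟨j_eq_zero_of_belyiDegree_eq_three W, belyiDegree_eq_three_of_j_eq_zero W⟩

/-- **`deg_B(E) = 4` for every elliptic curve with `j(E) = 1728`** (`char K = 0`): by
`belyiDegree_eq_of_j_eq` and `belyiDegree_j1728_eq_four` for `y² = x³ + x`.
[cite: Zapponi2009BelyiDegree, Example 1.2] -/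
theorem belyiDegree_eq_four_of_j_eq_1728 (W : WeierstrassCurve K) [W.IsElliptic]
    (hj : W.j = 1728) : belyiDegree (AlgebraicClosure K) W.geomFunctionField = 4 := by
  haveI : Fact (IsUnit (2 : K)) := ⟨isUnit_iff_ne_zero.2 two_ne_zero⟩
  rw [belyiDegree_eq_of_j_eq W (WeierstrassCurve.ofJ1728 K)
    (hj.trans (WeierstrassCurve.ofJ1728_j K).symm)]
  exact belyiDegree_j1728_eq_four (WeierstrassCurve.ofJ1728 K) rfl rfl rfl rfl

/-- **In the setting of `javanpeykar2014_stableFaltingsHeight_le`: `h_F(E) ≤ 13·10⁶ · 3⁵` for every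
elliptic curve with `j(E) = 0` over a number field**, modulo the named fact (its bound at the
smallest possible Belyi degree; `javanpeykar2014_stableFaltingsHeight_le.j_zero` of
`BelyiDegreeThree` had this for the models `y² = x³ + B` only).
[cite: Javanpeykar2014, Thm. 1.1.1] -/
theorem javanpeykar2014_stableFaltingsHeight_le.of_j_eq_zero
    (h : javanpeykar2014_stableFaltingsHeight_le) (K : Type) [Field K] [NumberField K]
    (W : WeierstrassCurve K) [W.IsElliptic] (hj : W.j = 0) :
    W.stableFaltingsHeight ≤ 13 * 10 ^ 6 * 3 ^ 5 := by
  have hb := h.le_belyiDegree_pow' K W (AlgebraicClosure K)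
  have h3 :
      belyiDegree (AlgebraicClosure K) (W.baseChange (AlgebraicClosure K)).toAffine.FunctionField =
        3 := belyiDegree_eq_three_of_j_eq_zero W hj
  rw [h3] at hb
  exact_mod_cast hb

end Models

/-! ### The same for an arbitrary algebraic closure `Ω` (the setting of the named fact; appended) -/

section AnyClosure

/-- **`deg_B(E_Ω) = 3 ↔ j(E) = 0`** for every algebraic closure `Ω` of `K` (`char K = 0`): the
quantity of `javanpeykar2014_stableFaltingsHeight_le` (`belyiDegree_baseChange_eq_geom` of
`BelyiTransportSemilinear`). [cite: Zapponi2009BelyiDegree, Example 1.2] -/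
theorem belyiDegree_baseChange_eq_three_iff_j_eq_zero (K : Type) [Field K] [CharZero K]
    (W : WeierstrassCurve K) [W.IsElliptic] (Ω : Type) [Field Ω] [Algebra K Ω] [IsAlgClosure K Ω] :
    belyiDegree Ω (W.baseChange Ω).toAffine.FunctionField = 3 ↔ W.j = 0 := by
  rw [belyiDegree_baseChange_eq_geom K W Ω]
  exact belyiDegree_eq_three_iff_j_eq_zero W

/-- **`deg_B(E_Ω) = 4` if `j(E) = 1728`**, for every algebraic closure `Ω`.
[cite: Zapponi2009BelyiDegree, Example 1.2] -/
theorem belyiDegree_baseChange_eq_four_of_j_eq_1728 (K : Type) [Field K] [CharZero K]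
    (W : WeierstrassCurve K) [W.IsElliptic] (Ω : Type) [Field Ω] [Algebra K Ω] [IsAlgClosure K Ω]
    (hj : W.j = 1728) : belyiDegree Ω (W.baseChange Ω).toAffine.FunctionField = 4 := by
  rw [belyiDegree_baseChange_eq_geom K W Ω]
  exact belyiDegree_eq_four_of_j_eq_1728 W hj

/-- **`deg_B(E_Ω) ≥ 4` if `j(E) ≠ 0`** (`E` over a number field, any algebraic closure `Ω`): the
right-hand side of Javanpeykar's bound is `≥ 13·10⁶ · 4⁵` off the `j = 0` class.
[cite: Javanpeykar2014, Thm. 1.1.1] -/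
theorem four_le_belyiDegree_baseChange_of_j_ne_zero (K : Type) [Field K] [NumberField K]
    (W : WeierstrassCurve K) [W.IsElliptic] (Ω : Type) [Field Ω] [Algebra K Ω] [IsAlgClosure K Ω]
    (hj : W.j ≠ 0) : 4 ≤ belyiDegree Ω (W.baseChange Ω).toAffine.FunctionField := by
  rw [belyiDegree_baseChange_eq_geom K W Ω]
  exact four_le_belyiDegree_of_j_ne_zero K W hj

end AnyClosure

/-! ### The named fact reduces to the fixed algebraic closure `K̄ = AlgebraicClosure K` -/

/-- **`javanpeykar2014_stableFaltingsHeight_le` is equivalent to its restriction to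
`Ω = AlgebraicClosure K`**, i.e. to the statement about `deg_B(K̄(E))`
(`WeierstrassCurve.geomFunctionField`, the function field on which the `EllipticCurves` machinery —
translations, `ordAt`, isogenies — operates): the Belyi degree does not depend on the algebraic
closure (`belyiDegree_baseChange_eq_geom`). A future discharge of the fact may therefore fix
`Ω = K̄`. [cite: Javanpeykar2014, Thm. 1.1.1] -/
theorem javanpeykar2014_stableFaltingsHeight_le_iff_geom :
    javanpeykar2014_stableFaltingsHeight_le ↔
      ∀ (K : Type) [Field K] [NumberField K] (W : WeierstrassCurve K) [W.IsElliptic],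
        W.stableFaltingsHeight ≤
          13 * 10 ^ 6 * (belyiDegree (AlgebraicClosure K) W.geomFunctionField : ℝ) ^ 5 := by
  rw [javanpeykar2014_stableFaltingsHeight_le_iff_belyiDegree]
  constructor
  · intro h K _ _ W _
    exact h K W (AlgebraicClosure K)
  · intro h K _ _ W _ Ω _ _ _
    rw [belyiDegree_baseChange_eq_geom K W Ω]
    exact h K W

end Literature.NumberTheory.DiophantineGeometry

end
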